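import Summits.FinalStateConjecture.FinalStateConjecture.Theorems.ZeroEnergyKerrOrBombStationaryLimitReductionProbeUniversalityGaugeCalculus
import Summits.FinalStateConjecture.FinalStateConjecture.Theorems.ZeroEnergyKerrOrBombStationaryLimitReductionStubProbeUniversality
import HarnessLib

/-!
# Route ZeroEnergyKerrOrBomb · crux `StationaryLimitReduction`, line `symplectic-dual-of-the-bomb`:
# stub `stub_probeUniversality`, wave 3 — junk census and honesty certificate of the Bridge

Stub `stub_probeUniversality : Sig.stub_probeUniversality` (crux stmt-FinalStateConjecture-10021, skeleton
r5, consumed in Case A1 of `StationaryLimitReduction_of`): `InTelescope 𝓑 → 𝓗⁺ ⊆ range A →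
¬ ModeStable 𝓑 → ∃ ν > 0, ϖ, h₁, h₂, IsGravitationalModePair 𝓑 A ν ϖ h₁ h₂` — "a scalar black-hole bomb
is a gravitational bomb". Standing verdict (wave 1, `probeUniversality_iff_bridge`): NONE-EXISTS — no
printed or tree theorem turns a growing mode of `□_g` into a growing mode of linearised gravity on a
general stationary vacuum hole. This wave-3 file re-attacks the TYPED text and records, kernel-checked,
why it cannot be closed cheaply either.

## Junk census

Clauses of `IsGravitationalModePair`: (a) symmetry; (b) smoothness on an open `U ⊇ d.o.c. ∪ 𝓗⁺`;
(c) `DRic_g hᵢ = 0` on the d.o.c.; (d) Killing eigen-equations on the d.o.c.; (e) chart-boundedness on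
`d.o.c. ∩ I⁻(far region)`; (f) not pure gauge on the d.o.c. `¬ ModeStable 𝓑` is a non-trivial scalar
Killing-mode pair `(ψ, χ)` of rate `ν > 0` (`not_modeStable_iff`). Two tensor pairs can be MANUFACTURED
from it, and both pass every clause that the tree's operators allow one to check by computation:

* the CONFORMAL pair `cᵢ = ψᵢ g` (`conformalPair_of_scalarModePair`): (a), (b) on the same `U`, (d)
  (`𝓛_T (ψ g) = (Tψ) g` for Killing `T`, `lieDerivBilin_smul_val_right_of_isKillingField`, through the
  honest value `∇(ψ g) = g ⊗ dψ` of the tree's `covDeriv₂`, `covDeriv₂_smul_val_apply`) and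
  non-triviality; it fails (c) classically (`DRic(ψ g) = −Hess ψ − ½ (□ψ) g` in dimension `4`), and the
  tree's `linearizedRicci` IS the honest operator there: (b) makes `hᵢ` smooth on an open set containing
  the d.o.c., where `covDeriv₂`/`covDeriv₃` take their classical values (their junk value `0` lives at
  non-representable points only) — (c) is not junk-satisfiable;
* the GAUGE pair `hᵢ = 𝓛_{ψᵢT} g = dψᵢ ⊗ T♭ + T♭ ⊗ dψᵢ` (`gaugePair_of_scalarModePair`): (a), (d)
  (`lieDerivBilin_smul_killing_eigenpair` of the companion file `…ProbeUniversalityGaugeCalculus.lean`),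
  non-triviality on the d.o.c. (where `(ψ, χ) ≠ 0` the eigen-equations force `(dψ, dχ) ≠ 0`, and
  `dψ ⊗ T♭ + T♭ ⊗ dψ ≠ 0` since `T ≠ 0` on the d.o.c., `symmProduct_ne_zero`), smooth gauge potentials
  `ξᵢ = ψᵢ T` on the d.o.c.; (c) holds classically (gauge invariance `DRic_g(𝓛_ξ g) = 𝓛_ξ Ric_g = 0` on
  the Ricci-flat hole — NOT in the tree, see below); (e) is NOT implied by the scalar boundedness clause
  (`|ψ| ≤ C` does not bound `dψ`); and (f) FAILS by construction (`not_isGravitationalModePair_of_gauge`).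

Hence `probeUniversality_sans_gauge_clause`: the stub's own hypotheses yield `ν > 0` and a NON-TRIVIAL
symmetric pair with the eigen-equations (d) which is pure gauge, so not a gravitational mode pair — the
gauge clause (f) is load-bearing; with it the stub is exactly the unprinted scalar-to-tensor bridge.
Other junk routes, all empty: the instance seam (the two `hasLeviCivita` spellings are one term); `h ≡ 0`
on the d.o.c. (gauge with `ξ = 0`); decoupling `ϖ = 0`, `h₂ = 0` (one real non-gauge growing mode is
still needed); vacuity of (e) (the outgoing region is non-empty, `outgoingRegion_nonempty`).

## What is missing for (c) of the gauge pair (gauge invariance of linearised gravity)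

`linearizedRicci (lieDerivBilin ξ g.val) x = 0` on a Ricci-flat background (Wald (C.2.15)–(C.2.17)) is not
in the tree and out of reach of its present curvature API. It needs: (i) an evaluation lemma for
`covDeriv₃` (`BachTensor.lean` has only `covDeriv₃_apply_of_exists`; the tensoriality argument of
`LeviCivitaCovDerivProofs.lean` exists for two slots) plus differentiability of `y ↦ covDeriv₂ w y` as a
bundle section; (ii) the Ricci identity for `(0,2)`-tensors `w_{XY;ZV} − w_{XY;VZ} = −w(R(V,Z)X, Y) −
w(X, R(V,Z)Y)` at manifold level (the tree has it for vector fields, `riemann_apply_eq_leviCivita₂_sub`,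
and in coordinates, `CoordTensorRicciIdentity.lean`); (iii) third derivatives `∇³ξ` and the contracted
second Bianchi identity at manifold level (coordinates only, `CoordBianchi.lean`). Given (i)–(iii),
`DRic(𝓛_ξ g) = 𝓛_ξ Ric` is a page of Wald §7.5.

## Verdict

stub-blocked on the missing theorem `ScalarToTensorModeBridge ≡ Sig.stub_probeUniversality` (a conjecture —
every known bomb mechanism is spin-blind, but no `s = 0 ⇒ s = 2` transfer exists off Petrov type D); it is
deliberately not filed as a Literature fact.
-/

-- every `Summit.FinalStateConjecture.FinalStateConjecture.…` name repeats the summit = sub-problem segment (D-0017 layout)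
set_option linter.dupNamespace false
set_option maxSynthPendingDepth 3

noncomputable section

open scoped Manifold ContDiff Topology
open Set Bundle Filter FiberBundle Literature.Geometry.Lorentzian

namespace Summit.FinalStateConjecture.FinalStateConjecture.Theorems.SymplecticDualOfTheBomb

open Summit.FinalStateConjecture.FinalStateConjecture.Theorems.OneLockedExplosion

/-! ## §1 The conformal candidate: `∇(f g) = g ⊗ df` and `𝓛_T (f g) = (Tf) g` for Killing `T` -/

section General

variable {E : Type*} [NormedAddCommGroup E] [NormedSpace ℝ E] {H : Type*} [TopologicalSpace H]
  {I : ModelWithCorners ℝ E H} {M : Type*} [TopologicalSpace M] [ChartedSpace H M]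
  [IsManifold I ∞ M] {n : ℕ∞ω} {x : M}
  (g : PseudoRiemannianMetric I n E (TangentSpace I : M → Type _))
  [Fact (1 ≤ n)] [FiniteDimensional ℝ E] [CompleteSpace E] [g.HasLeviCivita]

omit [CompleteSpace E] in
/-- **`∇(f g) = g ⊗ df`**: for `f` differentiable at `x`, `(∇_{Z₀}(f g))(X₀, Y₀) = df(Z₀) g(X₀, Y₀)` — the
tree's `covDeriv₂` takes its honest value on `y ↦ f(y) g_y` (`covDeriv₂_apply_extend_of_forall`: the
scalar functions `f · g(X, Y)` are differentiable), and `Z(f g(X̃,Ỹ)) − f g(∇_Z X̃, Y) − f g(X, ∇_Z Ỹ)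
= (Zf) g(X,Y)` by the product rule and metric compatibility. O'Neill 1983, Ch. 3, Prop. 3.18 and
Thm. 3.11 (D5). [folklore] -/
theorem covDeriv₂_smul_val_apply {f : M → ℝ} (hf : MDiffAt f x) (X₀ Y₀ Z₀ : TangentSpace I x) :
    g.covDeriv₂ (fun y ↦ f y • g.val y) x X₀ Y₀ Z₀ = mvfderiv I f x Z₀ * g.val x X₀ Y₀ := by
  have hLC : g.IsLeviCivita g.leviCivita := PseudoRiemannianMetric.isLeviCivita_leviCivita_holds
  have hk : ∀ X Y : Π x : M, TangentSpace I x, MDiffAt (T% X) x → MDiffAt (T% Y) x →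
      MDiffAt (fun y ↦ (f y • g.val y) (X y) (Y y)) x := by
    intro X Y hX hY
    have e : (fun y ↦ (f y • g.val y) (X y) (Y y)) = f * fun y ↦ g.val y (X y) (Y y) := by
      funext y; simp [smul_eq_mul]
    rw [e]
    exact hf.mul (g.mdifferentiableAt_val_apply hX hY)
  have hXd : MDiffAt (T% (extend E X₀ : Π y : M, TangentSpace I y)) x := mdifferentiableAt_extend ..
  have hYd : MDiffAt (T% (extend E Y₀ : Π y : M, TangentSpace I y)) x := mdifferentiableAt_extend ..
  have hZd : MDiffAt (T% (extend E Z₀ : Π y : M, TangentSpace I y)) x := mdifferentiableAt_extend ..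
  have hc := hLC.2 hZd hXd hYd
  simp only [extend_apply_self] at hc
  have e : (fun y ↦ (f y • g.val y) (extend E X₀ y) (extend E Y₀ y)) =
      f * fun y ↦ g.val y (extend E X₀ y) (extend E Y₀ y) := by
    funext y; simp [smul_eq_mul]
  rw [covDeriv₂_apply_extend_of_forall g hk, PseudoRiemannianMetric.covDeriv₂Aux, e,
    mvfderiv_mul hf (g.mdifferentiableAt_val_apply hXd hYd)]
  simp only [add_apply, smul_apply, smul_eq_mul, extend_apply_self, hc]
  ring

omit [CompleteSpace E] in
/-- **`𝓛_T (f g) = (Tf) g` for a Killing field `T`** (`f` differentiable at `x`): the conformal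
perturbation `f g` is a `T`-eigen-tensor as soon as `f` is a `T`-eigenfunction (`∇_T(f g) = (Tf) g` by
`covDeriv₂_smul_val_apply`, and `f·[g(∇_V T, W) + g(V, ∇_W T)] = 0` by Killing's equation). Wald 1984,
(C.2.14) with (C.3.1). [cite: Wald1984GR, Appendix C.3, (C.3.1)] -/
theorem lieDerivBilin_smul_val_right_of_isKillingField {T : Π x : M, TangentSpace I x} {f : M → ℝ}
    (hT : g.IsKillingField T) (hf : MDiffAt f x) :
    g.lieDerivBilin T (fun y ↦ f y • g.val y) x = mvfderiv I f x (T x) • g.val x := by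
  ext V W
  rw [PseudoRiemannianMetric.lieDerivBilin_apply, covDeriv₂_smul_val_apply g hf]
  have hK := hT.2 x V W
  simp only [smul_apply, smul_eq_mul]
  linear_combination (f x) * hK

end General

/-! ## §2 Algebra: the symmetrised product of two non-zero covectors is non-zero -/

section Algebra

variable {V : Type*} [AddCommGroup V] [Module ℝ V] [TopologicalSpace V]

omit [TopologicalSpace V] in
/-- Two non-zero linear forms have a common vector outside both kernels (a vector space is not the
union of two proper subspaces). [folklore] -/
theorem exists_apply_ne_zero_and_apply_ne_zero (α θ : V →ₗ[ℝ] ℝ) (hα : α ≠ 0) (hθ : θ ≠ 0) :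
    ∃ v : V, α v ≠ 0 ∧ θ v ≠ 0 := by
  obtain ⟨a, ha⟩ : ∃ a, α a ≠ 0 := by
    by_contra h
    push Not at h
    exact hα (LinearMap.ext fun v ↦ by simpa using h v)
  obtain ⟨t, ht⟩ : ∃ t, θ t ≠ 0 := by
    by_contra h
    push Not at h
    exact hθ (LinearMap.ext fun v ↦ by simpa using h v)
  by_cases h1 : θ a = 0
  · by_cases h2 : α t = 0
    · refine ⟨a + t, ?_, ?_⟩
      · simpa [map_add, h2] using ha
      · simpa [map_add, h1] using ht
    · exact ⟨t, h2, ht⟩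
  · exact ⟨a, ha, h1⟩

/-- **The symmetrised product `α ⊗ θ + θ ⊗ α` of two non-zero covectors is non-zero** (evaluate on
`(v, v)` with `α v ≠ 0 ≠ θ v`). Used for `dψ ⊗ T♭ + T♭ ⊗ dψ = 𝓛_{ψT} g`. [folklore] -/
theorem symmProduct_ne_zero (α θ : V →L[ℝ] ℝ) (hα : α ≠ 0) (hθ : θ ≠ 0)
    (h : V →L[ℝ] V →L[ℝ] ℝ) (hh : ∀ v w, h v w = α v * θ w + α w * θ v) : h ≠ 0 := by
  obtain ⟨v, hv, hv'⟩ := exists_apply_ne_zero_and_apply_ne_zero α.toLinearMap θ.toLinearMap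
    (fun e ↦ hα (by ext v; simpa using LinearMap.congr_fun e v))
    (fun e ↦ hθ (by ext v; simpa using LinearMap.congr_fun e v))
  intro h0
  have : h v v = 0 := by simp [h0]
  rw [hh] at this
  have : α v * θ v = 0 := by linarith
  simp only [ContinuousLinearMap.coe_coe] at hv hv'
  rcases mul_eq_zero.1 this with h' | h' <;> contradiction

end Algebra

/-! ## §3 The two manufactured pairs on a stationary hole, and the certificate -/

section Hole

/-- **The conformal pair of a scalar Killing-mode pair passes clauses (a), (b), (d) of
`IsGravitationalModePair` and is non-trivial** (junk census, candidate 1). For `ψ, χ` smooth on an open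
`U ⊇ d.o.c. ∪ 𝓗⁺` with `dψ(T) = νψ − ϖχ`, `dχ(T) = ϖψ + νχ` on the d.o.c. (clauses (i), (iii) of
`IsKillingModePair`), the pair `cᵢ = ψᵢ g`: is symmetric; is smooth on `U` in the bundle of bilinear forms
(the spelling of clause (b): `ContMDiffOn.smul_section` of the metric section); satisfies
`𝓛_T c₁ = ν c₁ − ϖ c₂`, `𝓛_T c₂ = ϖ c₁ + ν c₂` on the d.o.c. (`lieDerivBilin_smul_val_right_of_isKillingField`);
and `cᵢ(p) ≠ 0` wherever `ψᵢ(p) ≠ 0` (`g_p ≠ 0`, nondegeneracy). It is only the linearised-Ricci clause (c)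
that rules this candidate out (`DRic(ψ g) = −Hess ψ − ½ □ψ g`, classically; the tree's `linearizedRicci` is
honest on such smooth fields). Registered helper of stub `stub_probeUniversality` (lead a2 wave 3). [folklore] -/
theorem conformalPair_of_scalarModePair : ∀ (𝓑 : StationaryAFBlackHole.{0}) (U : Set 𝓑.carrier) (ν ϖ : ℝ) (ψ χ : 𝓑.carrier → ℝ), IsOpen U → 𝓑.doc ∪ 𝓑.horizon ⊆ U → ContMDiffOn (𝓡 4) 𝓘(ℝ, ℝ) ((⊤ : ℕ∞) : WithTop ℕ∞) ψ U → ContMDiffOn (𝓡 4) 𝓘(ℝ, ℝ) ((⊤ : ℕ∞) : WithTop ℕ∞) χ U → (∀ x ∈ 𝓑.doc, mfderiv (𝓡 4) 𝓘(ℝ, ℝ) ψ x (𝓑.killing x) = ν * ψ x - ϖ * χ x ∧ mfderiv (𝓡 4) 𝓘(ℝ, ℝ) χ x (𝓑.killing x) = ϖ * ψ x + ν * χ x) → haveI : 𝓑.metric.HasLeviCivita := 𝓑.metric.hasLeviCivita; (∀ p (v w : TangentSpace (𝓡 4) p), (ψ p • 𝓑.metric.val p) v w = (ψ p • 𝓑.metric.val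 p) w v ∧ (χ p • 𝓑.metric.val p) v w = (χ p • 𝓑.metric.val p) w v) ∧ (ContMDiffOn (𝓡 4) ((𝓡 4).prod 𝓘(ℝ, E4 →L[ℝ] E4 →L[ℝ] ℝ)) ∞ (fun p ↦ TotalSpace.mk' (E4 →L[ℝ] E4 →L[ℝ] ℝ) (E := fun p : 𝓑.carrier ↦ TangentSpace (𝓡 4) p →L[ℝ] TangentSpace (𝓡 4) p →L[ℝ] ℝ) p (ψ p • 𝓑.metric.val p)) U ∧ ContMDiffOn (𝓡 4) ((𝓡 4).prod 𝓘(ℝ, E4 →L[ℝ] E4 →L[ℝ] ℝ)) ∞ (fun p ↦ TotalSpace.mk' (E4 →L[ℝ] E4 →L[ℝ] ℝ) (E := fun p : 𝓑.carrier ↦ TangentSpace (𝓡 4) p →L[ℝ] TangentSpace (𝓡 4) p →L[ℝ] ℝ) p (χ p • 𝓑.metric.val p)) U) ∧ (∀ p ∈ 𝓑.doc, 𝓑.metric.toPseudoRiemannianMetric.lieDerivBilin 𝓑.killing (fun q ↦ ψ q • 𝓑.metric.val q) p = ν • (ψ p • 𝓑.metric.val p) - ϖ • (χ p • 𝓑.metric.val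 p) ∧ 𝓑.metric.toPseudoRiemannianMetric.lieDerivBilin 𝓑.killing (fun q ↦ χ q • 𝓑.metric.val q) p = ϖ • (ψ p • 𝓑.metric.val p) + ν • (χ p • 𝓑.metric.val p)) ∧ (∀ p, (ψ p ≠ 0 ∨ χ p ≠ 0) → ψ p • 𝓑.metric.val p ≠ 0 ∨ χ p • 𝓑.metric.val p ≠ 0) := by
  intro 𝓑 U ν ϖ ψ χ hUo hUsub hψU hχU heig
  haveI : 𝓑.metric.HasLeviCivita := 𝓑.metric.hasLeviCivita
  have hdocU : 𝓑.doc ⊆ U := subset_union_left.trans hUsub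
  have hT : 𝓑.metric.toPseudoRiemannianMetric.IsKillingField 𝓑.killing :=
    𝓑.isStationary.isKillingField
  have hψd : ∀ y ∈ 𝓑.doc, MDifferentiableAt (𝓡 4) 𝓘(ℝ, ℝ) ψ y := fun y hy ↦
    ((hψU y (hdocU hy)).contMDiffAt (hUo.mem_nhds (hdocU hy))).mdifferentiableAt (by simp)
  have hχd : ∀ y ∈ 𝓑.doc, MDifferentiableAt (𝓡 4) 𝓘(ℝ, ℝ) χ y := fun y hy ↦
    ((hχU y (hdocU hy)).contMDiffAt (hUo.mem_nhds (hdocU hy))).mdifferentiableAt (by simp)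
  -- the metric is nowhere the zero form
  have hg0 : ∀ p : 𝓑.carrier, (𝓑.metric.val p : TangentSpace (𝓡 4) p →L[ℝ]
      TangentSpace (𝓡 4) p →L[ℝ] ℝ) ≠ 0 := by
    intro p h0
    obtain ⟨v, hv⟩ := exists_ne (0 : E4)
    exact hv (𝓑.metric.nondegenerate p v fun w ↦ by rw [h0]; rfl)
  refine ⟨fun p v w ↦ ⟨?_, ?_⟩, ⟨?_, ?_⟩, fun p hp ↦ ⟨?_, ?_⟩, fun p hp0 ↦ ?_⟩
  · simp only [smul_apply, 𝓑.metric.symm p v w]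
  · simp only [smul_apply, 𝓑.metric.symm p v w]
  · exact hψU.smul_section 𝓑.metric.contMDiff.contMDiffOn
  · exact hχU.smul_section 𝓑.metric.contMDiff.contMDiffOn
  · rw [lieDerivBilin_smul_val_right_of_isKillingField _ hT (hψd p hp)]
    have e : mvfderiv (𝓡 4) ψ p (𝓑.killing p) = ν * ψ p - ϖ * χ p := (heig p hp).1
    rw [e, sub_smul, mul_smul, mul_smul]
  · rw [lieDerivBilin_smul_val_right_of_isKillingField _ hT (hχd p hp)]
    have e : mvfderiv (𝓡 4) χ p (𝓑.killing p) = ϖ * ψ p + ν * χ p := (heig p hp).2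
    rw [e, add_smul, mul_smul, mul_smul]
  · rcases hp0 with h | h
    · exact Or.inl (smul_ne_zero h (hg0 p))
    · exact Or.inr (smul_ne_zero h (hg0 p))

/-- **The gauge pair of a scalar black-hole bomb: every cheap clause, non-trivial, and killed by the gauge
clause** (junk census, candidate 2 — the honesty certificate). On a stationary hole whose Killing field
does not vanish on the d.o.c. (a clause of `InTelescope`), a scalar Killing-mode pair `(ψ, χ)` of rate
`ν > 0` which is non-zero somewhere on the d.o.c. (i.e. a witness of `¬ ModeStable`, `not_modeStable_iff`)
yields the pair `hᵢ = 𝓛_{ψᵢT} g` which (a) is symmetric (`lieDerivBilin_val_swap`), (d) satisfies the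
Killing eigen-equations of `IsGravitationalModePair` on the d.o.c. (`lieDerivBilin_smul_killing_eigenpair`),
is NON-ZERO at the very point where `(ψ, χ) ≠ 0` (there the eigen-equations give `(dψ, dχ) ≠ 0`:
`(ν² + ϖ²) ψ = ν dψ(T) + ϖ dχ(T)`; and `dψ ⊗ T♭ + T♭ ⊗ dψ ≠ 0` for `dψ ≠ 0 ≠ T♭`, `symmProduct_ne_zero`,
`lieDerivBilin_smul_val_apply_of_isKillingField`, nondegeneracy), has gauge potentials `ψᵢ T` smooth on the
d.o.c. (`ContMDiffOn.smul_section`) — and is therefore NOT a gravitational mode pair in any chart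
(`not_isGravitationalModePair_of_gauge`, p104705): clause (f) alone excludes it. Registered helper of stub
`stub_probeUniversality` (lead a2 wave 3). [cite: Wald1984GR, Appendix C.2, (C.2.15)–(C.2.17)] -/
theorem gaugePair_of_scalarModePair : ∀ (𝓑 : StationaryAFBlackHole.{0}) (A : 𝓑.AdaptedChart) (ν ϖ : ℝ) (ψ χ : 𝓑.carrier → ℝ), (∀ p ∈ 𝓑.doc, 𝓑.killing p ≠ 0) → 0 < ν → (haveI : 𝓑.metric.HasLeviCivita := 𝓑.metric.hasLeviCivita; 𝓑.IsKillingModePair ν ϖ ψ χ) → (∃ x ∈ 𝓑.doc, ψ x ≠ 0 ∨ χ x ≠ 0) → haveI : 𝓑.metric.HasLeviCivita := 𝓑.metric.hasLeviCivita; (∀ p (v w : TangentSpace (𝓡 4) p), 𝓑.metric.toPseudoRiemannianMetric.lieDerivBilin (ψ • 𝓑.killing) 𝓑.metric.val p v w = 𝓑.metric.toPseudoRiemannianMetric.lieDerivBilin (ψ • 𝓑.killing) 𝓑.metric.val p w v ∧ 𝓑.metric.toPseudoRiemannianMetric.lieDerivBilin (χ • 𝓑.killing) 𝓑.metric.val p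 v w = 𝓑.metric.toPseudoRiemannianMetric.lieDerivBilin (χ • 𝓑.killing) 𝓑.metric.val p w v) ∧ (∀ p ∈ 𝓑.doc, 𝓑.metric.toPseudoRiemannianMetric.lieDerivBilin 𝓑.killing (𝓑.metric.toPseudoRiemannianMetric.lieDerivBilin (ψ • 𝓑.killing) 𝓑.metric.val) p = ν • 𝓑.metric.toPseudoRiemannianMetric.lieDerivBilin (ψ • 𝓑.killing) 𝓑.metric.val p - ϖ • 𝓑.metric.toPseudoRiemannianMetric.lieDerivBilin (χ • 𝓑.killing) 𝓑.metric.val p ∧ 𝓑.metric.toPseudoRiemannianMetric.lieDerivBilin 𝓑.killing (𝓑.metric.toPseudoRiemannianMetric.lieDerivBilin (χ • 𝓑.killing) 𝓑.metric.val) p = ϖ • 𝓑.metric.toPseudoRiemannianMetric.lieDerivBilin (ψ • 𝓑.killing) 𝓑.metric.val p + ν • 𝓑.metric.toPseudoRiemannianMetric.lieDerivBilin (χ • 𝓑.killing) 𝓑.metric.val p) ∧ (∃ p ∈ 𝓑.doc, 𝓑.metric.toPseudoRiemannianMetric.lieDerivBilin (ψ • 𝓑.killing) 𝓑.metric.val p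 ≠ 0 ∨ 𝓑.metric.toPseudoRiemannianMetric.lieDerivBilin (χ • 𝓑.killing) 𝓑.metric.val p ≠ 0) ∧ (ContMDiffOn (𝓡 4) ((𝓡 4).prod 𝓘(ℝ, E4)) ∞ (fun p ↦ (TotalSpace.mk' E4 p ((ψ • 𝓑.killing) p) : TangentBundle (𝓡 4) 𝓑.carrier)) 𝓑.doc ∧ ContMDiffOn (𝓡 4) ((𝓡 4).prod 𝓘(ℝ, E4)) ∞ (fun p ↦ (TotalSpace.mk' E4 p ((χ • 𝓑.killing) p) : TangentBundle (𝓡 4) 𝓑.carrier)) 𝓑.doc) ∧ ¬ IsGravitationalModePair 𝓑 A ν ϖ (𝓑.metric.toPseudoRiemannianMetric.lieDerivBilin (ψ • 𝓑.killing) 𝓑.metric.val) (𝓑.metric.toPseudoRiemannianMetric.lieDerivBilin (χ • 𝓑.killing) 𝓑.metric.val) := by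
  intro 𝓑 A ν ϖ ψ χ hT0 hν hpair hne
  haveI : 𝓑.metric.HasLeviCivita := 𝓑.metric.hasLeviCivita
  obtain ⟨⟨U, hUo, hUsub, hψU, hχU⟩, -, heig, -⟩ := hpair
  obtain ⟨x, hx, hx0⟩ := hne
  have hdocU : 𝓑.doc ⊆ U := subset_union_left.trans hUsub
  have hT : 𝓑.metric.toPseudoRiemannianMetric.IsKillingField 𝓑.killing :=
    𝓑.isStationary.isKillingField
  have hψd : ∀ y ∈ 𝓑.doc, MDifferentiableAt (𝓡 4) 𝓘(ℝ, ℝ) ψ y := fun y hy ↦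
    ((hψU y (hdocU hy)).contMDiffAt (hUo.mem_nhds (hdocU hy))).mdifferentiableAt (by simp)
  have hχd : ∀ y ∈ 𝓑.doc, MDifferentiableAt (𝓡 4) 𝓘(ℝ, ℝ) χ y := fun y hy ↦
    ((hχU y (hdocU hy)).contMDiffAt (hUo.mem_nhds (hdocU hy))).mdifferentiableAt (by simp)
  refine ⟨fun p v w ↦ ⟨?_, ?_⟩, lieDerivBilin_smul_killing_eigenpair 𝓑 U ν ϖ ψ χ hUo hdocU hψU hχU heig,
    ⟨x, hx, ?_⟩, ⟨?_, ?_⟩, ?_⟩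
  · exact PseudoRiemannianMetric.lieDerivBilin_val_swap _ _ p v w
  · exact PseudoRiemannianMetric.lieDerivBilin_val_swap _ _ p v w
  · -- non-triviality at `x`: one of `dψ_x`, `dχ_x` is non-zero, and `T_x ≠ 0`
    have hθ : (𝓑.metric.val x (𝓑.killing x) : TangentSpace (𝓡 4) x →L[ℝ] ℝ) ≠ 0 := by
      intro h0
      refine hT0 x hx (𝓑.metric.nondegenerate x (𝓑.killing x) fun w ↦ ?_)
      rw [h0]
      rfl
    have hd : mvfderiv (𝓡 4) ψ x ≠ 0 ∨ mvfderiv (𝓡 4) χ x ≠ 0 := by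
      by_contra hcon
      push Not at hcon
      obtain ⟨e₁, e₂⟩ := heig x hx
      have f₁ : (0 : ℝ) = ν * ψ x - ϖ * χ x := by
        rw [← e₁]
        exact (congrArg (fun L : TangentSpace (𝓡 4) x →L[ℝ] ℝ ↦ L (𝓑.killing x)) hcon.1).symm
      have f₂ : (0 : ℝ) = ϖ * ψ x + ν * χ x := by
        rw [← e₂]
        exact (congrArg (fun L : TangentSpace (𝓡 4) x →L[ℝ] ℝ ↦ L (𝓑.killing x)) hcon.2).symm
      have hsq : ν * ν + ϖ * ϖ ≠ 0 :=
        (add_pos_of_pos_of_nonneg (mul_pos hν hν) (mul_self_nonneg ϖ)).ne'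
      have k₁ : ψ x = 0 := by
        refine (mul_eq_zero.mp ?_).resolve_left hsq
        linear_combination -(ν * f₁ + ϖ * f₂)
      have k₂ : χ x = 0 := by
        refine (mul_eq_zero.mp ?_).resolve_left hsq
        linear_combination ϖ * f₁ - ν * f₂
      exact hx0.elim (fun h ↦ h k₁) (fun h ↦ h k₂)
    rcases hd with hd | hd
    · refine Or.inl (symmProduct_ne_zero (mvfderiv (𝓡 4) ψ x) _ hd hθ _ fun v w ↦ ?_)
      rw [lieDerivBilin_smul_val_apply_of_isKillingField _ hT (hψd x hx), 𝓑.metric.symm x v]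
    · refine Or.inr (symmProduct_ne_zero (mvfderiv (𝓡 4) χ x) _ hd hθ _ fun v w ↦ ?_)
      rw [lieDerivBilin_smul_val_apply_of_isKillingField _ hT (hχd x hx), 𝓑.metric.symm x v]
  · exact (hψU.mono hdocU).smul_section hT.1.contMDiffOn
  · exact (hχU.mono hdocU).smul_section hT.1.contMDiffOn
  · exact not_isGravitationalModePair_of_gauge 𝓑 A ν ϖ _ _ (ψ • 𝓑.killing) (χ • 𝓑.killing)
      ((hψU.mono hdocU).smul_section hT.1.contMDiffOn)
      ((hχU.mono hdocU).smul_section hT.1.contMDiffOn) (fun p _ ↦ ⟨rfl, rfl⟩)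

/-- **`Sig.stub_probeUniversality` without its gauge clause is junk-true — and the junk witness is gauge.**
Under the stub's own hypotheses (`InTelescope 𝓑`, whose last clause is `T ≠ 0` on the d.o.c.; the collar
hypothesis `𝓗⁺ ⊆ range A` is not needed; `¬ ModeStable 𝓑`) there are `ν > 0`, `ϖ` and fields `h₁, h₂` with
clause (a) (symmetry) and clause (d) (Killing eigen-equations) of `IsGravitationalModePair`, non-zero
somewhere on the d.o.c., which are pure gauge with d.o.c.-smooth potentials and hence NOT a gravitational
mode pair: the scalar bomb of `not_modeStable_iff` fed through `gaugePair_of_scalarModePair`. So the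
registered conclusion cannot be reached from `¬ ModeStable` by this (or, by the module docstring's census,
any other typed) shortcut: what remains is the unprinted scalar-to-tensor bridge itself
(`probeUniversality_iff_bridge`). Registered helper of stub `stub_probeUniversality` (lead a2 wave 3). [folklore] -/
theorem probeUniversality_sans_gauge_clause : ∀ (𝓑 : StationaryAFBlackHole.{0}) (A : 𝓑.AdaptedChart), InTelescope 𝓑 → 𝓑.horizon ⊆ Set.range A.toFun → ¬ ModeStable 𝓑 → haveI : 𝓑.metric.HasLeviCivita := 𝓑.metric.hasLeviCivita; ∃ (ν ϖ : ℝ) (h₁ h₂ : HoleBilinField 𝓑), 0 < ν ∧ (∀ p (v w : TangentSpace (𝓡 4) p), h₁ p v w = h₁ p w v ∧ h₂ p v w = h₂ p w v) ∧ (∀ p ∈ 𝓑.doc, 𝓑.metric.toPseudoRiemannianMetric.lieDerivBilin 𝓑.killing h₁ p = ν • h₁ p - ϖ • h₂ p ∧ 𝓑.metric.toPseudoRiemannianMetric.lieDerivBilin 𝓑.killing h₂ p = ϖ • h₁ p + ν • h₂ p) ∧ (∃ p ∈ 𝓑.doc, h₁ p ≠ 0 ∨ h₂ p ≠ 0) ∧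 (∃ ξ₁ ξ₂ : (p : 𝓑.carrier) → TangentSpace (𝓡 4) p, ContMDiffOn (𝓡 4) ((𝓡 4).prod 𝓘(ℝ, E4)) ∞ (fun p ↦ (TotalSpace.mk' E4 p (ξ₁ p) : TangentBundle (𝓡 4) 𝓑.carrier)) 𝓑.doc ∧ ContMDiffOn (𝓡 4) ((𝓡 4).prod 𝓘(ℝ, E4)) ∞ (fun p ↦ (TotalSpace.mk' E4 p (ξ₂ p) : TangentBundle (𝓡 4) 𝓑.carrier)) 𝓑.doc ∧ ∀ p ∈ 𝓑.doc, h₁ p = 𝓑.metric.toPseudoRiemannianMetric.lieDerivBilin ξ₁ 𝓑.metric.val p ∧ h₂ p = 𝓑.metric.toPseudoRiemannianMetric.lieDerivBilin ξ₂ 𝓑.metric.val p) ∧ ¬ IsGravitationalModePair 𝓑 A ν ϖ h₁ h₂ := by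
  intro 𝓑 A hreg _ hms
  haveI : 𝓑.metric.HasLeviCivita := 𝓑.metric.hasLeviCivita
  obtain ⟨ν, ϖ, ψ, χ, hν, hpair, hne⟩ := (not_modeStable_iff 𝓑).1 hms
  obtain ⟨hsymm, heigen, hnz, ⟨hs₁, hs₂⟩, hnot⟩ :=
    gaugePair_of_scalarModePair 𝓑 A ν ϖ ψ χ hreg.2.2.2.2 hν hpair hne
  exact ⟨ν, ϖ, _, _, hν, hsymm, heigen, hnz, ⟨ψ • 𝓑.killing, χ • 𝓑.killing, hs₁, hs₂,
    fun p _ ↦ ⟨rfl, rfl⟩⟩, hnot⟩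

end Hole

end Summit.FinalStateConjecture.FinalStateConjecture.Theorems.SymplecticDualOfTheBomb

end
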